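import Literature.Barriers.CriticalPhenomena.WeaklySAWFlowStructuralStability
import HarnessLib

/-!
# [BBS-rg-flow, Lemma 2.1] in the printed generality: the flow `ḡ_{j+1} = ḡ_j - β_jḡ_j²` under
# Assumption (A1) (bounded `β`, exceptional scales, weights `χ_j = Ω^{-(j-j_Ω)₊}`)

Second file of the series formalising [BBS-rg-flow] (Bauerschmidt–Brydges–Slade, AHP 16 (2015),
arXiv:1211.2477), the abstract dynamical-system input (BBS 2015, Theorem 7.2.1) of Theorem 4.1 of
BBS 2015, towards `Literature.Barriers.CriticalPhenomena.WeaklySAWFourDimLogCorrections`; it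
continues `WeaklySAWFlowStructuralStability.lean` (vocabulary: `cutoffWeight`, `chi`, `jOmega`,
`HypA1`) and generalises `WeaklySAWCouplingFlow.lean` (the case `β ≥ 0`, no weights).

Lemma 2.1 of the source controls the sequence `ḡ` under Assumption (A1) ALONE: `β` bounded, `β_j ≥ c`
for all but `c⁻¹` scales `j ≤ j_Ω` (so finitely many `β_j` may be small or NEGATIVE), and
`|β_j| ≤ χ_jβ_max` beyond the cut-off. Everything is proved here for an ARBITRARY cut-off
`k ∈ ℕ ∪ {∞}` in place of `j_Ω` (the source uses nothing else about `j_Ω`), packaged as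
`CutoffGbarHyp β Ω k B c N g₀` with explicit smallness of `g₀` ("`ḡ₀ > 0` sufficiently small, with all
constants independent of `j_Ω` and `ḡ₀`"), and `HypA1.cutoffGbarHyp` derives it from `HypA1` at
`k = j_Ω`, `N = ⌊c⁻¹⌋`, for all `0 < g₀ ≤ gbarThreshold Ω B c` (an explicit threshold). With explicit
constants in place of the printed `O(·)`:
* (i) [`gbar_pos`, `gbar_le_two_mul`, `abs_gbar_div_succ_sub_one_le`]: `ḡ_j > 0`,
  `ḡ_i ≤ 2ḡ_{i'}` for `i' ≤ i` ("`ḡ_j = O(inf_{k≤j} ḡ_k)`"), `|ḡ_j/ḡ_{j+1} - 1| ≤ 2|β_j|ḡ_j ≤ 4Bg₀χ_j`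
  ("`ḡ_jḡ_{j+1}⁻¹ = 1 + O(χ_jḡ_j) = 1 + O(ḡ₀)`"), by the printed induction: the factors `1 - β_lḡ_l`
  exceeding `1` come from the exceptional scales and from the geometric tail `Σ_{l>j_Ω}|β_l| = O(1)`
  (`sum_posPart_le_of_cutoff`, `prod_one_add_le_inv_one_sub_sum`);
* (ii)(a), (2.3) for `(n,m) = (2,0)` and `(1,0)` [`sum_weight_mul_gbar_sq_le`,
  `summable_weight_mul_gbar_sq`, `sum_weight_mul_gbar_le`]:
  `Σ_{l=j}^m χ_lḡ_l² ≤ ((1+N)/c + N + 2Ω/(Ω-1)) χ_jḡ_j` and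
  `Σ_{l=j}^m χ_lḡ_l ≤ ((5+N)/c + N + Ω/(Ω-1)) |log ḡ_m|`, by the discrete form of the printed
  sum/integral comparison (2.4): `β_lḡ_l² = ḡ_l - ḡ_{l+1}` and `β_lḡ_l ≤ log(ḡ_l/ḡ_{l+1})` telescope on
  the good scales, the exceptional scales and the tail beyond the cut-off are `O(ḡ_j)`;
* (iii)(b) [`prod_inv_one_sub_zeta_mul_gbar_le_two`, `half_le_prod_one_sub_zeta_mul_gbar`]: for
  `|ζ_l| ≤ C_ζχ_l` with `ζ_l ≤ 0` off finitely many `l ≤ k` (Assumption (A2)),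
  `∏_{l ∈ t}(1 - ζ_lḡ_l)⁻¹ ≤ 2` for every finite set `t` of scales.

Deliberately NOT here: (2.3) for `n = 2, m ≥ 1` and real `n` (not needed downstream in this form),
(ii)(b) (`χ_jḡ_jⁿ ≤ C_n(ḡ₀/(1+ḡ₀j))ⁿ`, by comparison flows), (iii)(a) for general `γ` (the case
`γ ∈ [0,1]`, `β ≥ 0` is `WeaklySAWCouplingFlowProduct.lean`), (iv) and the monotonicity in `β_k`
(the case `β ≥ 0` is `WeaklySAWCouplingFlowComparison.lean`) — next files of the series.

## References
* R. Bauerschmidt, D. C. Brydges, G. Slade, *Structural stability of a dynamical system near a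
  non-hyperbolic fixed point*, Ann. Henri Poincaré 16 (2015), arXiv:1211.2477: Assumption (A1),
  Lemma 2.1 (i), (ii)(a) (2.3)–(2.6), (iii)(b) (2.7), and their proofs. [BauerschmidtBrydgesSlade2015Flow]
* R. Bauerschmidt, D. C. Brydges, G. Slade, CMP 337 (2015), §6.1 (Assumption (A1); "we fix Ω > 1
  arbitrarily"). [BauerschmidtBrydgesSlade2015LogCorr]
-/

noncomputable section

open Filter Topology Set
open scoped BigOperators

namespace Literature.Barriers.CriticalPhenomena

namespace CTWSAW

/-! ## [BBS-rg-flow, Lemma 2.1] in the printed generality (arbitrary cut-off, exceptional scales) -/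

/-! ### Sums of the weights beyond the cut-off -/

/-- For a finite cut-off `k` and scales `l ≥ l₀ > k` (`l ∈ t`):
`Σ_{l ∈ t} Ω^{-(l-k)} ≤ (Ω/(Ω-1)) Ω^{-(l₀-k)₊}` (a geometric tail; for `k = ∞` the sum is empty).
[cite: BauerschmidtBrydgesSlade2015Flow, Lemma 2.1 (proof of (i): "Σ_{l ≥ j_Ω} |β_l| ≤ Σ_n Ω^{-n} = O(1)")] -/
theorem sum_cutoffWeight_le {Ω : ℝ} (hΩ : 1 < Ω) (k : ℕ∞) (t : Finset ℕ) (l₀ : ℕ)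
    (hk : ∀ l ∈ t, k < (l : ℕ∞)) (hl₀ : ∀ l ∈ t, l₀ ≤ l) :
    ∑ l ∈ t, cutoffWeight Ω k l ≤ Ω / (Ω - 1) * cutoffWeight Ω k l₀ := by
  have hΩ0 : 0 < Ω := by linarith
  induction k with
  | top =>
    have : t = ∅ := Finset.eq_empty_of_forall_notMem fun l hl => by simpa using hk l hl
    subst this
    simp only [Finset.sum_empty, cutoffWeight_top, mul_one]
    exact div_nonneg hΩ0.le (by linarith)
  | coe k =>
    set r : ℝ := Ω⁻¹ with hr
    have hr0 : 0 ≤ r := by positivity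
    have hr1 : r < 1 := inv_lt_one_of_one_lt₀ hΩ
    have hw : ∀ l : ℕ, cutoffWeight Ω (k : ℕ∞) l = r ^ (l - k) := fun l => by
      simp [cutoffWeight_coe, hr, inv_pow]
    -- every `l ∈ t` is `> k` and `≥ l₀`; put `l₁ = max l₀ (k+1)`
    set l₁ : ℕ := max l₀ (k + 1) with hl₁
    have hl₁t : ∀ l ∈ t, l₁ ≤ l := fun l hl => by
      have h1 := hl₀ l hl
      have h2 : k < l := by exact_mod_cast hk l hl
      omega
    have hkey : ∑ l ∈ t, r ^ (l - k) ≤ r ^ (l₁ - k) * (1 - r)⁻¹ := by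
      have hsplit : ∀ l ∈ t, r ^ (l - k) = r ^ (l₁ - k) * r ^ (l - l₁) := fun l hl => by
        rw [← pow_add]; congr 1; have := hl₁t l hl; omega
      rw [Finset.sum_congr rfl hsplit, ← Finset.mul_sum]
      refine mul_le_mul_of_nonneg_left ?_ (by positivity)
      -- reindex by the injection `l ↦ l - l₁`
      have hinj : Set.InjOn (fun l => l - l₁) (t : Set ℕ) := by
        intro a ha b hb hab
        have := hl₁t a ha; have := hl₁t b hb
        simp only at hab; omega
      rw [← Finset.sum_image (f := fun i => r ^ i) hinj]
      calc ∑ i ∈ t.image (fun l => l - l₁), r ^ i ≤ ∑' i, r ^ i :=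
            (summable_geometric_of_lt_one hr0 hr1).sum_le_tsum _ (fun i _ => by positivity)
        _ = (1 - r)⁻¹ := tsum_geometric_of_lt_one hr0 hr1
    have hgeom : (1 - r)⁻¹ = Ω / (Ω - 1) := by
      rw [hr]; field_simp
    have hmono : r ^ (l₁ - k) ≤ r ^ (l₀ - k) := pow_le_pow_of_le_one hr0 hr1.le (by omega)
    calc ∑ l ∈ t, cutoffWeight Ω (k : ℕ∞) l = ∑ l ∈ t, r ^ (l - k) := by simp_rw [hw]
      _ ≤ r ^ (l₁ - k) * (1 - r)⁻¹ := hkey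
      _ ≤ r ^ (l₀ - k) * (1 - r)⁻¹ := by gcongr
      _ = Ω / (Ω - 1) * cutoffWeight Ω (k : ℕ∞) l₀ := by rw [hgeom, hw, mul_comm]

/-- Scales beyond the cut-off carry total weight `Σ_{l ∈ t, l > k} Ω^{-(l-k)} ≤ 1/(Ω-1)`.
[cite: BauerschmidtBrydgesSlade2015Flow, Lemma 2.1 (proof of (i))] -/
theorem sum_cutoffWeight_le_inv {Ω : ℝ} (hΩ : 1 < Ω) (k : ℕ∞) (t : Finset ℕ)
    (hk : ∀ l ∈ t, k < (l : ℕ∞)) : ∑ l ∈ t, cutoffWeight Ω k l ≤ 1 / (Ω - 1) := by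
  induction k with
  | top =>
    have : t = ∅ := Finset.eq_empty_of_forall_notMem fun l hl => by simpa using hk l hl
    subst this; simp only [Finset.sum_empty]; exact div_nonneg zero_le_one (by linarith)
  | coe k =>
    have h := sum_cutoffWeight_le hΩ (k : ℕ∞) t (k + 1) hk fun l hl => by
      have : k < l := by exact_mod_cast hk l hl
      omega
    have hw : cutoffWeight Ω (k : ℕ∞) (k + 1) = Ω⁻¹ := by simp
    rw [hw] at h
    have hΩ0 : (0 : ℝ) < Ω := by linarith
    calc _ ≤ Ω / (Ω - 1) * Ω⁻¹ := h
      _ = 1 / (Ω - 1) := by field_simp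

/-- Weights are antitone in the scale: `l₀ ≤ l → Ω^{-(l-k)₊} ≤ Ω^{-(l₀-k)₊}` (for `Ω ≥ 1`).
[cite: BauerschmidtBrydgesSlade2015Flow, §1.3, (1.8)] -/
theorem cutoffWeight_antitone {Ω : ℝ} (hΩ : 1 ≤ Ω) (k : ℕ∞) : Antitone (cutoffWeight Ω k) :=
  antitone_nat_of_succ_le (cutoffWeight_succ_le hΩ k)

/-! ### Two elementary product inequalities -/

/-- For `a_l ≥ 0` with `Σ a_l < 1`: `∏ (1 + a_l) ≤ (1 - Σ a_l)⁻¹`. [folklore] -/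
theorem prod_one_add_le_inv_one_sub_sum {ι : Type*} (t : Finset ι) (a : ι → ℝ)
    (h0 : ∀ l ∈ t, 0 ≤ a l) (h1 : ∑ l ∈ t, a l < 1) :
    ∏ l ∈ t, (1 + a l) ≤ (1 - ∑ l ∈ t, a l)⁻¹ := by
  classical
  induction t using Finset.induction_on with
  | empty => simp
  | insert i t hi ih =>
    rw [Finset.sum_insert hi] at h1
    rw [Finset.prod_insert hi, Finset.sum_insert hi]
    have hai : 0 ≤ a i := h0 i (by simp)
    have hS : 0 ≤ ∑ l ∈ t, a l := Finset.sum_nonneg fun l hl => h0 l (by simp [hl])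
    have ih' := ih (fun l hl => h0 l (by simp [hl])) (by linarith)
    have hpos : 0 < 1 - ∑ l ∈ t, a l := by linarith
    have hpos' : 0 < 1 - (a i + ∑ l ∈ t, a l) := by linarith
    calc (1 + a i) * ∏ l ∈ t, (1 + a l) ≤ (1 + a i) * (1 - ∑ l ∈ t, a l)⁻¹ := by gcongr
      _ ≤ (1 - (a i + ∑ l ∈ t, a l))⁻¹ := by
        rw [← div_eq_mul_inv, div_le_iff₀ hpos, inv_mul_eq_div, le_div_iff₀ hpos']
        nlinarith


/-! ### Coefficients carried by exceptional scales and by scales beyond the cut-off -/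

/-- If `|ζ_l| ≤ C Ω^{-(l-k)₊}` for all `l` and `ζ_l ≤ 0` for all `l ≤ k` outside a finite set `s'`,
then for any finite set `t` of scales `Σ_{l ∈ t} (ζ_l)₊ ≤ C(#s' + 1/(Ω-1))`: the positive part is
carried by the exceptional scales and by the geometric tail beyond the cut-off. (Used with `ζ = -β`
in Lemma 2.1(i) and with `ζ` of Assumption (A2) in Lemma 2.1(iii)(b).)
[cite: BauerschmidtBrydgesSlade2015Flow, Lemma 2.1 (proofs of (i) and (iii)(b))] -/
theorem sum_posPart_le_of_cutoff {Ω : ℝ} (hΩ : 1 < Ω) (k : ℕ∞) {ζ : ℕ → ℝ} {C : ℝ} (hC : 0 ≤ C)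
    (s' : Finset ℕ) (hz : ∀ l, |ζ l| ≤ C * cutoffWeight Ω k l)
    (hexc : ∀ l : ℕ, (l : ℕ∞) ≤ k → l ∉ s' → ζ l ≤ 0) (t : Finset ℕ) :
    ∑ l ∈ t, max (ζ l) 0 ≤ C * (s'.card + 1 / (Ω - 1)) := by
  classical
  have hw1 : ∀ l, cutoffWeight Ω k l ≤ 1 := fun l => (cutoffWeight_pos_and_le_one hΩ.le k l).2
  have hw0 : ∀ l, 0 < cutoffWeight Ω k l := fun l => (cutoffWeight_pos_and_le_one hΩ.le k l).1
  -- termwise: `(ζ_l)₊ ≤ C w_l (1_{l ∈ s'} + 1_{k < l})`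
  have hterm : ∀ l, max (ζ l) 0 ≤
      C * cutoffWeight Ω k l * (if l ∈ s' then 1 else 0) +
        C * cutoffWeight Ω k l * (if k < (l : ℕ∞) then 1 else 0) := by
    intro l
    have hw := hw0 l
    rcases le_or_gt (ζ l) 0 with hl | hl
    · rw [max_eq_right hl]; positivity
    · have hls : l ∈ s' ∨ k < (l : ℕ∞) := by
        by_contra hcon
        rw [not_or, not_lt] at hcon
        have := hexc l hcon.2 hcon.1
        linarith
      have habs : max (ζ l) 0 = |ζ l| := by rw [max_eq_left hl.le, abs_of_pos hl]
      rw [habs]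
      have h1 := hz l
      have h2 : 0 ≤ C * cutoffWeight Ω k l * (if k < (l : ℕ∞) then 1 else 0) := by positivity
      have h3 : 0 ≤ C * cutoffWeight Ω k l * (if l ∈ s' then 1 else 0) := by positivity
      rcases hls with hls | hls
      · simp only [hls, if_true, mul_one] at h3 ⊢; linarith
      · simp only [hls, if_true, mul_one] at h2 ⊢; linarith
  refine (Finset.sum_le_sum fun l _ => hterm l).trans ?_
  rw [Finset.sum_add_distrib, mul_add]
  gcongr
  · -- exceptional scales: at most `#s'` of them, each weight `≤ 1`
    calc ∑ l ∈ t, C * cutoffWeight Ω k l * (if l ∈ s' then 1 else 0)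
        = ∑ l ∈ t.filter (· ∈ s'), C * cutoffWeight Ω k l := by
          rw [Finset.sum_filter]; refine Finset.sum_congr rfl fun l _ => ?_; split <;> simp
      _ ≤ ∑ l ∈ t.filter (· ∈ s'), C := Finset.sum_le_sum fun l _ =>
          mul_le_of_le_one_right hC (hw1 l)
      _ = C * (t.filter (· ∈ s')).card := by rw [Finset.sum_const, nsmul_eq_mul, mul_comm]
      _ ≤ C * s'.card := by
          gcongr
          exact fun l (hl : l ∈ t.filter (· ∈ s')) => (Finset.mem_filter.1 hl).2
  · -- beyond the cut-off: geometric tail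
    calc ∑ l ∈ t, C * cutoffWeight Ω k l * (if k < (l : ℕ∞) then 1 else 0)
        = C * ∑ l ∈ t.filter (fun l : ℕ => k < (l : ℕ∞)), cutoffWeight Ω k l := by
          rw [Finset.sum_filter, Finset.mul_sum]
          refine Finset.sum_congr rfl fun l _ => ?_; split <;> simp
      _ ≤ C * (1 / (Ω - 1)) := by
          gcongr
          exact sum_cutoffWeight_le_inv hΩ k _ fun l hl => (Finset.mem_filter.1 hl).2

/-! ### Hypotheses of Lemma 2.1 for an arbitrary cut-off, with explicit constants and smallness -/

/-- The hypotheses of [BBS-rg-flow, Lemma 2.1] on the sequence `β`, for an ARBITRARY cut-off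
`k ∈ ℕ ∪ {∞}` in place of `j_Ω` (the proofs of §2 use `j_Ω` only through these properties), with
explicit constants and with "`ḡ₀ > 0` sufficiently small (depending on `β_max` and `c`)" made explicit:
`Ω > 1`; `|β_j| ≤ B Ω^{-(j-k)₊}` (Assumption (A1): `β` bounded, and `|β_j| ≤ χ_jβ_max` by the definition
(1.7) of `j_Ω`); `β_j ≥ c > 0` for all `j ≤ k` outside an exceptional finite set of at most `N` scales
(`N = ⌊c⁻¹⌋` in (A1)); `0 < g₀ ≤ 1/4`, `Bg₀ ≤ 1/4`, `2Bg₀(N + 1/(Ω-1)) ≤ 1/2`. Obtained from `HypA1` in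
`HypA1.cutoffGbarHyp`. [cite: BauerschmidtBrydgesSlade2015Flow, Assumption (A1) and Lemma 2.1] -/
structure CutoffGbarHyp (β : ℕ → ℝ) (Ω : ℝ) (k : ℕ∞) (B c : ℝ) (N : ℕ) (g₀ : ℝ) : Prop where
  /-- `Ω > 1`. -/
  one_lt : 1 < Ω
  /-- `|β_j| ≤ BΩ^{-(j-k)₊}`. -/
  abs_le : ∀ j, |β j| ≤ B * cutoffWeight Ω k j
  /-- `c > 0`. -/
  c_pos : 0 < c
  /-- `β_j ≥ c` for `j ≤ k` off an exceptional set of at most `N` scales. -/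
  exc : ∃ s : Finset ℕ, s.card ≤ N ∧ ∀ j : ℕ, (j : ℕ∞) ≤ k → j ∉ s → c ≤ β j
  /-- `g₀ > 0`. -/
  g₀_pos : 0 < g₀
  /-- smallness: `g₀ ≤ 1/4`. -/
  g₀_le : g₀ ≤ 1 / 4
  /-- smallness: `Bg₀ ≤ 1/4`. -/
  smallB : B * g₀ ≤ 1 / 4
  /-- smallness: `2Bg₀(N + 1/(Ω-1)) ≤ 1/2`. -/
  smallN : 2 * B * g₀ * (N + 1 / (Ω - 1)) ≤ 1 / 2

namespace CutoffGbarHyp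

variable {β : ℕ → ℝ} {Ω : ℝ} {k : ℕ∞} {B c : ℝ} {N : ℕ} {g₀ : ℝ} (h : CutoffGbarHyp β Ω k B c N g₀)
include h

/-- `Ω ≥ 1`. [cite: BauerschmidtBrydgesSlade2015Flow, §1.3 (Ω > 1)] -/
theorem one_le : 1 ≤ Ω := h.one_lt.le

/-- `0 < Ω^{-(j-k)₊}`. [cite: BauerschmidtBrydgesSlade2015Flow, §1.3, (1.8)] -/
theorem weight_pos (j : ℕ) : 0 < cutoffWeight Ω k j := (cutoffWeight_pos_and_le_one h.one_le k j).1

/-- `Ω^{-(j-k)₊} ≤ 1`. [cite: BauerschmidtBrydgesSlade2015Flow, §1.3, (1.8)] -/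
theorem weight_le_one (j : ℕ) : cutoffWeight Ω k j ≤ 1 := (cutoffWeight_pos_and_le_one h.one_le k j).2

/-- `B ≥ 0`. [cite: BauerschmidtBrydgesSlade2015Flow, Assumption (A1)] -/
theorem B_nonneg : 0 ≤ B := by
  have h1 := h.abs_le 0
  have h2 := h.weight_pos 0
  by_contra hB
  have : B * cutoffWeight Ω k 0 < 0 := mul_neg_of_neg_of_pos (lt_of_not_ge hB) h2
  linarith [abs_nonneg (β 0)]

/-- `|β_j| ≤ B`. [cite: BauerschmidtBrydgesSlade2015Flow, Assumption (A1)] -/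
theorem abs_le_B (j : ℕ) : |β j| ≤ B :=
  (h.abs_le j).trans (mul_le_of_le_one_right h.B_nonneg (h.weight_le_one j))

/-- The negative part of `β_j` is carried by the exceptional scales and the scales beyond the cut-off:
for any finite set `t` of scales, `Σ_{j ∈ t} (-β_j)₊ ≤ B(N + 1/(Ω-1))`.
[cite: BauerschmidtBrydgesSlade2015Flow, Lemma 2.1 (proof of (i))] -/
theorem sum_negPart_le (t : Finset ℕ) : ∑ j ∈ t, max (-β j) 0 ≤ B * (N + 1 / (Ω - 1)) := by
  obtain ⟨s, hsN, hs⟩ := h.exc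
  have h1 := sum_posPart_le_of_cutoff h.one_lt k (ζ := fun j => -β j) h.B_nonneg s
    (fun l => by simpa [abs_neg] using h.abs_le l)
    (fun l hl hls => by have := hs l hl hls; have := h.c_pos; show -β l ≤ 0; linarith) t
  refine h1.trans (mul_le_mul_of_nonneg_left ?_ h.B_nonneg)
  have : (s.card : ℝ) ≤ N := by exact_mod_cast hsN
  linarith

/-! ### [BBS-rg-flow, Lemma 2.1(i)]: positivity and `ḡ_j = O(inf_{i ≤ j} ḡ_i)` -/

omit h in
/-- The product form of the recursion: `ḡ_{i+n} = ḡ_i ∏_{l<n} (1 - β_{i+l}ḡ_{i+l})`.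
[cite: BauerschmidtBrydgesSlade2015Flow, Lemma 2.1 (proof of (i), ḡ_{j+1} = ḡ_j(1 - β_jḡ_j))] -/
theorem gbar_add_eq_mul_prod (i n : ℕ) :
    gbar β g₀ (i + n) = gbar β g₀ i * ∏ l ∈ Finset.range n, (1 - β (i + l) * gbar β g₀ (i + l)) := by
  induction n with
  | zero => simp
  | succ n ih => rw [Finset.prod_range_succ, ← mul_assoc, ← ih, ← add_assoc, gbar_succ']

/-- The simultaneous induction of the proof of Lemma 2.1(i): positivity and `ḡ_i ≤ 2ḡ_{i'}` for
`i' ≤ i`. [cite: BauerschmidtBrydgesSlade2015Flow, Lemma 2.1(i) (proof)] -/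
theorem gbar_pos_and_le_two_mul (n : ℕ) :
    (∀ i ≤ n, 0 < gbar β g₀ i) ∧ ∀ i' i, i' ≤ i → i ≤ n → gbar β g₀ i ≤ 2 * gbar β g₀ i' := by
  induction n with
  | zero =>
    refine ⟨fun i hi => ?_, fun i' i h1 h2 => ?_⟩
    · rw [Nat.le_zero.1 hi, gbar_zero]; exact h.g₀_pos
    · obtain rfl := Nat.le_zero.1 h2; obtain rfl := Nat.le_zero.1 h1
      rw [gbar_zero]; linarith [h.g₀_pos]
  | succ n ih =>
    obtain ⟨ihpos, ihle⟩ := ih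
    -- for `l ≤ n`: `0 < ḡ_l ≤ 2g₀`, hence `|β_l|ḡ_l ≤ 1/2`
    have hle2g : ∀ l ≤ n, gbar β g₀ l ≤ 2 * g₀ := fun l hl => by
      simpa using ihle 0 l (Nat.zero_le l) hl
    have hsmall : ∀ l ≤ n, |β l| * gbar β g₀ l ≤ 1 / 2 := fun l hl => by
      calc |β l| * gbar β g₀ l ≤ B * (2 * g₀) :=
            mul_le_mul (h.abs_le_B l) (hle2g l hl) (ihpos l hl).le h.B_nonneg
        _ ≤ 1 / 2 := by linarith [h.smallB]
    have hfac : ∀ l ≤ n, 1 / 2 ≤ 1 - β l * gbar β g₀ l := fun l hl => by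
      have := hsmall l hl
      have : β l * gbar β g₀ l ≤ |β l| * gbar β g₀ l :=
        mul_le_mul_of_nonneg_right (le_abs_self _) (ihpos l hl).le
      linarith
    have hposn1 : 0 < gbar β g₀ (n + 1) := by
      rw [gbar_succ']
      exact mul_pos (ihpos n le_rfl) (by linarith [hfac n le_rfl])
    refine ⟨fun i hi => ?_, fun i' i h1 h2 => ?_⟩
    · rcases Nat.lt_or_ge i (n + 1) with hi' | hi'
      · exact ihpos i (Nat.lt_succ_iff.1 hi')
      · rw [le_antisymm hi hi']; exact hposn1
    · rcases Nat.lt_or_ge i (n + 1) with hi' | hi'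
      · exact ihle i' i h1 (Nat.lt_succ_iff.1 hi')
      have hi_eq : i = n + 1 := le_antisymm h2 hi'
      subst hi_eq
      rcases Nat.lt_or_ge i' (n + 1) with h1' | h1'
      swap
      · rw [le_antisymm h1 h1']; linarith [hposn1]
      -- `i' ≤ n`: product formula over `Ico i' (n+1)`
      have hi'n : i' ≤ n := Nat.lt_succ_iff.1 h1'
      obtain ⟨m, hm⟩ : ∃ m, n + 1 = i' + m := ⟨n + 1 - i', by omega⟩
      rw [hm, gbar_add_eq_mul_prod i' m]
      have hpos' := ihpos i' hi'n
      suffices hprod : ∏ l ∈ Finset.range m, (1 - β (i' + l) * gbar β g₀ (i' + l)) ≤ 2 by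
        calc gbar β g₀ i' * ∏ l ∈ Finset.range m, (1 - β (i' + l) * gbar β g₀ (i' + l))
            ≤ gbar β g₀ i' * 2 := by gcongr
          _ = 2 * gbar β g₀ i' := by ring
      -- compare with `∏ (1 + a_l)`, `a_l = (-β_l)₊ ḡ_l`, and use `Σ a_l ≤ 1/2`
      have hlm : ∀ l ∈ Finset.range m, i' + l ≤ n := fun l hl => by
        have := Finset.mem_range.1 hl; omega
      set a : ℕ → ℝ := fun l => max (-β (i' + l)) 0 * gbar β g₀ (i' + l) with ha
      have ha0 : ∀ l ∈ Finset.range m, 0 ≤ a l := fun l hl =>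
        mul_nonneg (le_max_right _ _) (ihpos _ (hlm l hl)).le
      have hsum : ∑ l ∈ Finset.range m, a l ≤ 1 / 2 := by
        calc ∑ l ∈ Finset.range m, a l ≤ ∑ l ∈ Finset.range m, max (-β (i' + l)) 0 * (2 * g₀) :=
              Finset.sum_le_sum fun l hl =>
                mul_le_mul_of_nonneg_left (hle2g _ (hlm l hl)) (le_max_right _ _)
          _ = (∑ l ∈ Finset.range m, max (-β (i' + l)) 0) * (2 * g₀) := by
              rw [Finset.sum_mul]
          _ = (∑ j ∈ (Finset.range m).image (i' + ·), max (-β j) 0) * (2 * g₀) := by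
              rw [Finset.sum_image fun a _ b _ hab => by simpa using hab]
          _ ≤ B * (N + 1 / (Ω - 1)) * (2 * g₀) :=
              mul_le_mul_of_nonneg_right (h.sum_negPart_le _) (by linarith [h.g₀_pos])
          _ ≤ 1 / 2 := by nlinarith [h.smallN]
      calc ∏ l ∈ Finset.range m, (1 - β (i' + l) * gbar β g₀ (i' + l))
          ≤ ∏ l ∈ Finset.range m, (1 + a l) := by
            refine Finset.prod_le_prod (fun l hl => by linarith [hfac _ (hlm l hl)]) fun l hl => ?_
            have hg := (ihpos _ (hlm l hl)).le
            have : -β (i' + l) * gbar β g₀ (i' + l) ≤ max (-β (i' + l)) 0 * gbar β g₀ (i' + l) :=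
              mul_le_mul_of_nonneg_right (le_max_left _ _) hg
            simp only [ha]; linarith
        _ ≤ (1 - ∑ l ∈ Finset.range m, a l)⁻¹ :=
            prod_one_add_le_inv_one_sub_sum _ a ha0 (by linarith)
        _ ≤ 2 := by
            rw [inv_le_comm₀ (by linarith) two_pos]; linarith

/-- `ḡ_j > 0` for all `j`. [cite: BauerschmidtBrydgesSlade2015Flow, Lemma 2.1(i)] -/
theorem gbar_pos (j : ℕ) : 0 < gbar β g₀ j := (h.gbar_pos_and_le_two_mul j).1 j le_rfl

/-- `ḡ_j = O(inf_{i ≤ j} ḡ_i)` with constant `2`: `ḡ_i ≤ 2ḡ_{i'}` for `i' ≤ i`.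
[cite: BauerschmidtBrydgesSlade2015Flow, Lemma 2.1(i), (2.2) (first statement)] -/
theorem gbar_le_two_mul {i' i : ℕ} (hi : i' ≤ i) : gbar β g₀ i ≤ 2 * gbar β g₀ i' :=
  (h.gbar_pos_and_le_two_mul i).2 i' i hi le_rfl

/-- `ḡ_j ≤ 2g₀` ("`ḡ_j = O(ḡ₀)`", Proposition 1.2). [cite: BauerschmidtBrydgesSlade2015Flow, Lemma 2.1(i) and Proposition 1.2] -/
theorem gbar_le_two_mul_init (j : ℕ) : gbar β g₀ j ≤ 2 * g₀ := by
  simpa using h.gbar_le_two_mul (Nat.zero_le j)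

/-- `ḡ_j ≤ 1/2`. [cite: BauerschmidtBrydgesSlade2015Flow, Lemma 2.1(i)] -/
theorem gbar_le_half (j : ℕ) : gbar β g₀ j ≤ 1 / 2 := by linarith [h.gbar_le_two_mul_init j, h.g₀_le]

/-- `|β_j|ḡ_j ≤ 2Bg₀ Ω^{-(j-k)₊}` — the "`O(χ_jḡ_j)`" of (2.2). [cite: BauerschmidtBrydgesSlade2015Flow, Lemma 2.1(i), (2.2)] -/
theorem abs_beta_mul_gbar_le (j : ℕ) : |β j| * gbar β g₀ j ≤ 2 * B * g₀ * cutoffWeight Ω k j := by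
  calc |β j| * gbar β g₀ j ≤ B * cutoffWeight Ω k j * (2 * g₀) :=
        mul_le_mul (h.abs_le j) (h.gbar_le_two_mul_init j) (h.gbar_pos j).le
          (mul_nonneg h.B_nonneg (h.weight_pos j).le)
    _ = 2 * B * g₀ * cutoffWeight Ω k j := by ring

/-- `|β_j|ḡ_j ≤ 1/2`. [cite: BauerschmidtBrydgesSlade2015Flow, Lemma 2.1(i) (proof)] -/
theorem abs_beta_mul_gbar_le_half (j : ℕ) : |β j| * gbar β g₀ j ≤ 1 / 2 := by
  have := h.abs_beta_mul_gbar_le j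
  have : 2 * B * g₀ * cutoffWeight Ω k j ≤ 2 * B * g₀ := by
    have := h.weight_le_one j; have := h.B_nonneg; have := h.g₀_pos
    exact mul_le_of_le_one_right (by positivity) ‹_›
  linarith [h.smallB]

/-- `1/2 ≤ 1 - β_jḡ_j ≤ 3/2`. [cite: BauerschmidtBrydgesSlade2015Flow, Lemma 2.1(i) (proof)] -/
theorem one_sub_mem (j : ℕ) : 1 - β j * gbar β g₀ j ∈ Set.Icc (1 / 2 : ℝ) (3 / 2) := by
  have h1 := h.abs_beta_mul_gbar_le_half j
  have h2 : |β j * gbar β g₀ j| ≤ 1 / 2 := by rwa [abs_mul, abs_of_pos (h.gbar_pos j)]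
  constructor <;> linarith [neg_abs_le (β j * gbar β g₀ j), le_abs_self (β j * gbar β g₀ j)]

/-- `ḡ_{j+1}/ḡ_j = 1 - β_jḡ_j`. [cite: BauerschmidtBrydgesSlade2015Flow, Lemma 2.1 (proof of (i), first display)] -/
theorem gbar_succ_div (j : ℕ) : gbar β g₀ (j + 1) / gbar β g₀ j = 1 - β j * gbar β g₀ j := by
  rw [gbar_succ', mul_div_cancel_left₀ _ (h.gbar_pos j).ne']

/-- `ḡ_{j+1} ≥ ḡ_j/2` and `ḡ_{j+1} ≤ (3/2)ḡ_j`. [cite: BauerschmidtBrydgesSlade2015Flow, Lemma 2.1(i)] -/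
theorem gbar_succ_mem (j : ℕ) :
    gbar β g₀ (j + 1) ∈ Set.Icc (gbar β g₀ j / 2) (3 / 2 * gbar β g₀ j) := by
  obtain ⟨h1, h2⟩ := h.one_sub_mem j
  have hg := h.gbar_pos j
  rw [gbar_succ']
  constructor <;> nlinarith

/-- The second statement of (2.2), quantitatively: `|ḡ_j/ḡ_{j+1} - 1| ≤ 2|β_j|ḡ_j (≤ 4Bg₀Ω^{-(j-k)₊})`,
i.e. `ḡ_jḡ_{j+1}⁻¹ = 1 + O(χ_jḡ_j) = 1 + O(ḡ₀)`. [cite: BauerschmidtBrydgesSlade2015Flow, Lemma 2.1(i), (2.2) (second statement)] -/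
theorem abs_gbar_div_succ_sub_one_le (j : ℕ) :
    |gbar β g₀ j / gbar β g₀ (j + 1) - 1| ≤ 2 * (|β j| * gbar β g₀ j) := by
  obtain ⟨h1, h2⟩ := h.one_sub_mem j
  have hg := h.gbar_pos j
  have hne : 1 - β j * gbar β g₀ j ≠ 0 := by linarith
  have hq : gbar β g₀ j / gbar β g₀ (j + 1) - 1 = β j * gbar β g₀ j / (1 - β j * gbar β g₀ j) := by
    rw [gbar_succ', ← div_div, div_self hg.ne', eq_div_iff hne, sub_mul, div_mul_cancel₀ _ hne]
    ring
  rw [hq, abs_div, abs_of_pos (a := 1 - β j * gbar β g₀ j) (by linarith),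
    div_le_iff₀ (by linarith : (0 : ℝ) < 1 - β j * gbar β g₀ j), abs_mul, abs_of_pos hg]
  have hA : 0 ≤ |β j| * gbar β g₀ j := mul_nonneg (abs_nonneg _) hg.le
  have hB : 1 ≤ 2 * (1 - β j * gbar β g₀ j) := by linarith
  calc |β j| * gbar β g₀ j = (|β j| * gbar β g₀ j) * 1 := (mul_one _).symm
    _ ≤ (|β j| * gbar β g₀ j) * (2 * (1 - β j * gbar β g₀ j)) := mul_le_mul_of_nonneg_left hB hA
    _ = 2 * (|β j| * gbar β g₀ j) * (1 - β j * gbar β g₀ j) := by ring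

end CutoffGbarHyp


namespace CutoffGbarHyp

variable {β : ℕ → ℝ} {Ω : ℝ} {k : ℕ∞} {B c : ℝ} {N : ℕ} {g₀ : ℝ} (h : CutoffGbarHyp β Ω k B c N g₀)
include h

/-! ### [BBS-rg-flow, Lemma 2.1(iii)(b)]: `∏_{k=j}^l (1 - ζ_kḡ_k)⁻¹ ≤ O(1)` -/

/-- For `|ζ_l| ≤ C_ζ Ω^{-(l-k)₊}` and `4C_ζg₀ ≤ 1`: `|ζ_lḡ_l| ≤ 2C_ζg₀Ω^{-(l-k)₊} ≤ 1/2`.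
[cite: BauerschmidtBrydgesSlade2015Flow, Lemma 2.1(iii)(b) (proof)] -/
theorem abs_zeta_mul_gbar_le {ζ : ℕ → ℝ} {Cz : ℝ} (hz : ∀ l, |ζ l| ≤ Cz * cutoffWeight Ω k l)
    (l : ℕ) : |ζ l * gbar β g₀ l| ≤ 2 * Cz * g₀ * cutoffWeight Ω k l := by
  have hCz : 0 ≤ Cz := by
    have h1 := hz 0; have h2 := h.weight_pos 0
    by_contra hC
    have : Cz * cutoffWeight Ω k 0 < 0 := mul_neg_of_neg_of_pos (lt_of_not_ge hC) h2
    linarith [abs_nonneg (ζ 0)]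
  rw [abs_mul, abs_of_pos (h.gbar_pos l)]
  calc |ζ l| * gbar β g₀ l ≤ Cz * cutoffWeight Ω k l * (2 * g₀) :=
        mul_le_mul (hz l) (h.gbar_le_two_mul_init l) (h.gbar_pos l).le
          (mul_nonneg hCz (h.weight_pos l).le)
    _ = 2 * Cz * g₀ * cutoffWeight Ω k l := by ring

/-- Under the hypotheses of Lemma 2.1(iii)(b) each factor satisfies `1/2 ≤ 1 - ζ_lḡ_l ≤ 3/2`.
[cite: BauerschmidtBrydgesSlade2015Flow, Lemma 2.1(iii)(b) (proof: "1/(1-x) ≤ 2eˣ for x ∈ [-1/2, 1/2]")] -/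
theorem one_sub_zeta_mul_gbar_mem {ζ : ℕ → ℝ} {Cz : ℝ} (hz : ∀ l, |ζ l| ≤ Cz * cutoffWeight Ω k l)
    (hsmall : 4 * Cz * g₀ ≤ 1) (l : ℕ) : 1 - ζ l * gbar β g₀ l ∈ Set.Icc (1 / 2 : ℝ) (3 / 2) := by
  have h1 := h.abs_zeta_mul_gbar_le hz l
  have h2 : 2 * Cz * g₀ * cutoffWeight Ω k l ≤ 1 / 2 := by
    have hw := h.weight_le_one l; have hw0 := h.weight_pos l
    have : 0 ≤ 2 * Cz * g₀ := by
      have := abs_nonneg (ζ l * gbar β g₀ l); nlinarith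
    nlinarith
  have h3 : |ζ l * gbar β g₀ l| ≤ 1 / 2 := h1.trans h2
  constructor <;> linarith [neg_abs_le (ζ l * gbar β g₀ l), le_abs_self (ζ l * gbar β g₀ l)]

/-- **[BBS-rg-flow, Lemma 2.1(iii)(b)]**, with explicit constant: if `|ζ_l| ≤ C_ζΩ^{-(l-k)₊}`, `ζ_l ≤ 0`
for all `l ≤ k` off a finite set `s'`, and `g₀` is small (`4C_ζg₀ ≤ 1`, `8C_ζg₀(#s' + 1/(Ω-1)) ≤ 1`),
then for every finite set `t` of scales `∏_{l ∈ t} (1 - ζ_lḡ_l)⁻¹ ≤ 2` ("`≤ O(1)` with a constant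
independent of `j` and `l`"). [cite: BauerschmidtBrydgesSlade2015Flow, Lemma 2.1(iii)(b), (2.7)] -/
theorem prod_inv_one_sub_zeta_mul_gbar_le_two {ζ : ℕ → ℝ} {Cz : ℝ} (s' : Finset ℕ)
    (hz : ∀ l, |ζ l| ≤ Cz * cutoffWeight Ω k l) (hexc : ∀ l : ℕ, (l : ℕ∞) ≤ k → l ∉ s' → ζ l ≤ 0)
    (hsmall1 : 4 * Cz * g₀ ≤ 1) (hsmall2 : 8 * Cz * g₀ * (s'.card + 1 / (Ω - 1)) ≤ 1)
    (t : Finset ℕ) : ∏ l ∈ t, (1 - ζ l * gbar β g₀ l)⁻¹ ≤ 2 := by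
  have hCz : 0 ≤ Cz := by
    have h1 := hz 0; have h2 := h.weight_pos 0
    by_contra hC
    have : Cz * cutoffWeight Ω k 0 < 0 := mul_neg_of_neg_of_pos (lt_of_not_ge hC) h2
    linarith [abs_nonneg (ζ 0)]
  -- `(1 - x_l)⁻¹ ≤ 1 + b_l`, `b_l = 2 (ζ_l)₊ ḡ_l`
  set b : ℕ → ℝ := fun l => 2 * max (ζ l) 0 * gbar β g₀ l with hb
  have hb0 : ∀ l, 0 ≤ b l := fun l => by
    have := h.gbar_pos l; simp only [hb]; positivity
  have hfac : ∀ l, (1 - ζ l * gbar β g₀ l)⁻¹ ≤ 1 + b l := by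
    intro l
    obtain ⟨hlo, hhi⟩ := h.one_sub_zeta_mul_gbar_mem hz hsmall1 l
    have hg := h.gbar_pos l
    rcases le_or_gt (ζ l) 0 with hζ | hζ
    · have hx : ζ l * gbar β g₀ l ≤ 0 := mul_nonpos_of_nonpos_of_nonneg hζ hg.le
      calc (1 - ζ l * gbar β g₀ l)⁻¹ ≤ 1 := inv_le_one_of_one_le₀ (by linarith)
        _ ≤ 1 + b l := by linarith [hb0 l]
    · have hx0 : 0 < ζ l * gbar β g₀ l := mul_pos hζ hg
      have hbl : b l = 2 * (ζ l * gbar β g₀ l) := by simp only [hb, max_eq_left hζ.le]; ring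
      rw [hbl, inv_eq_one_div, div_le_iff₀ (by linarith)]
      nlinarith
  have hsum : ∑ l ∈ t, b l ≤ 1 / 2 := by
    calc ∑ l ∈ t, b l ≤ ∑ l ∈ t, 2 * max (ζ l) 0 * (2 * g₀) :=
          Finset.sum_le_sum fun l _ => mul_le_mul_of_nonneg_left (h.gbar_le_two_mul_init l)
            (mul_nonneg zero_le_two (le_max_right _ _))
      _ = 4 * g₀ * ∑ l ∈ t, max (ζ l) 0 := by rw [Finset.mul_sum]; refine Finset.sum_congr rfl ?_; intros; ring
      _ ≤ 4 * g₀ * (Cz * (s'.card + 1 / (Ω - 1))) :=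
          mul_le_mul_of_nonneg_left (sum_posPart_le_of_cutoff h.one_lt k hCz s' hz hexc t)
            (by linarith [h.g₀_pos])
      _ ≤ 1 / 2 := by nlinarith
  calc ∏ l ∈ t, (1 - ζ l * gbar β g₀ l)⁻¹ ≤ ∏ l ∈ t, (1 + b l) :=
        Finset.prod_le_prod (fun l _ => inv_nonneg.2 (by linarith [(h.one_sub_zeta_mul_gbar_mem hz hsmall1 l).1]))
          fun l _ => hfac l
    _ ≤ (1 - ∑ l ∈ t, b l)⁻¹ := prod_one_add_le_inv_one_sub_sum t b (fun l _ => hb0 l) (by linarith)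
    _ ≤ 2 := by rw [inv_le_comm₀ (by linarith) two_pos]; linarith

/-- The lower-bound form of Lemma 2.1(iii)(b): `∏_{l ∈ t} (1 - ζ_lḡ_l) ≥ 1/2` (so the homogeneous
solutions of the `z̄`-equation do not decay; used for the uniqueness in Lemma 2.2).
[cite: BauerschmidtBrydgesSlade2015Flow, Lemma 2.1(iii)(b), (2.7)] -/
theorem half_le_prod_one_sub_zeta_mul_gbar {ζ : ℕ → ℝ} {Cz : ℝ} (s' : Finset ℕ)
    (hz : ∀ l, |ζ l| ≤ Cz * cutoffWeight Ω k l) (hexc : ∀ l : ℕ, (l : ℕ∞) ≤ k → l ∉ s' → ζ l ≤ 0)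
    (hsmall1 : 4 * Cz * g₀ ≤ 1) (hsmall2 : 8 * Cz * g₀ * (s'.card + 1 / (Ω - 1)) ≤ 1)
    (t : Finset ℕ) : 1 / 2 ≤ ∏ l ∈ t, (1 - ζ l * gbar β g₀ l) := by
  have hprod := h.prod_inv_one_sub_zeta_mul_gbar_le_two s' hz hexc hsmall1 hsmall2 t
  have hpos : 0 < ∏ l ∈ t, (1 - ζ l * gbar β g₀ l) :=
    Finset.prod_pos fun l _ => by linarith [(h.one_sub_zeta_mul_gbar_mem hz hsmall1 l).1]
  rw [Finset.prod_inv_distrib, inv_le_comm₀ hpos two_pos] at hprod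
  simpa [one_div] using hprod

/-! ### [BBS-rg-flow, Lemma 2.1(ii)(a)]: the sums `Σ_l χ_lḡ_lⁿ|log ḡ_l|ᵐ` for `(n,m) = (2,0), (1,0)` -/

/-- `ḡ_l² ≤ ḡ_j` for `l ≥ j` (as `ḡ_l ≤ 2ḡ_j` and `ḡ_l ≤ 1/2`). [cite: BauerschmidtBrydgesSlade2015Flow, Lemma 2.1(i)] -/
theorem gbar_sq_le {j l : ℕ} (hl : j ≤ l) : gbar β g₀ l ^ 2 ≤ gbar β g₀ j := by
  have h1 := h.gbar_le_two_mul hl; have h2 := h.gbar_le_half l; have h3 := h.gbar_pos l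
  nlinarith

/-- `|ḡ_l - ḡ_{l+1}| = |β_l|ḡ_l² ≤ ḡ_j` for `l ≥ j`. [cite: BauerschmidtBrydgesSlade2015Flow, Lemma 2.1 (proof of (ii)(a): |ḡ_l - ḡ_{l+1}| = |β_l|ḡ_l²)] -/
theorem abs_gbar_sub_succ_le {j l : ℕ} (hl : j ≤ l) : |gbar β g₀ l - gbar β g₀ (l + 1)| ≤ gbar β g₀ j := by
  have hq : gbar β g₀ l - gbar β g₀ (l + 1) = (β l * gbar β g₀ l) * gbar β g₀ l := by rw [gbar_succ]; ring
  rw [hq, abs_mul, abs_of_pos (h.gbar_pos l), abs_mul, abs_of_pos (h.gbar_pos l)]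
  have h1 := h.abs_beta_mul_gbar_le_half l; have h2 := h.gbar_le_two_mul hl; have h3 := h.gbar_pos l
  nlinarith [abs_nonneg (β l)]

omit h in
/-- Telescoping over an interval of scales. [folklore] -/
theorem sum_Icc_sub_succ (f : ℕ → ℝ) {j m : ℕ} (hjm : j ≤ m) :
    ∑ l ∈ Finset.Icc j m, (f l - f (l + 1)) = f j - f (m + 1) := by
  induction m with
  | zero => obtain rfl := Nat.le_zero.1 hjm; simp
  | succ m ih =>
    rcases Nat.lt_or_ge m j with hmj | hmj
    · have : j = m + 1 := by omega
      subst this; simp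
    · rw [Finset.sum_Icc_succ_top (by omega), ih hmj]; ring

omit h in
/-- The scales `≤ k` of an interval `[j, m]` form an interval `[j, m₁]`, `m₁ ≤ m`.
[cite: BauerschmidtBrydgesSlade2015Flow, Lemma 2.1 (proof of (ii)(a): the cases j ≤ j_Ω, l > j_Ω)] -/
theorem filter_le_cutoff_eq_Icc (k : ℕ∞) (j m : ℕ) :
    ∃ m₁, m₁ ≤ m ∧ (Finset.Icc j m).filter (fun l : ℕ => (l : ℕ∞) ≤ k) = Finset.Icc j m₁ := by
  induction k with
  | top => exact ⟨m, le_rfl, Finset.filter_true_of_mem fun l _ => le_top⟩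
  | coe k₀ =>
    refine ⟨min m k₀, min_le_left _ _, ?_⟩
    ext l
    simp only [Finset.mem_filter, Finset.mem_Icc, Nat.cast_le, le_min_iff]
    tauto

/-- The part of (2.3) with `(n, m) = (2, 0)` below the cut-off: for an interval `[j, m]` of scales
`≤ k`, `Σ_{l=j}^m ḡ_l² ≤ ((1+N)/c + N) ḡ_j` (telescoping `β_lḡ_l² = ḡ_l - ḡ_{l+1}` on the good scales).
[cite: BauerschmidtBrydgesSlade2015Flow, Lemma 2.1(ii)(a), (2.3) and its proof ((2.4)–(2.6), case j ≤ j_Ω)] -/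
theorem sum_gbar_sq_le_of_le_cutoff (j m : ℕ) (hm : ∀ l ∈ Finset.Icc j m, (l : ℕ∞) ≤ k) :
    ∑ l ∈ Finset.Icc j m, gbar β g₀ l ^ 2 ≤ ((1 + N) / c + N) * gbar β g₀ j := by
  classical
  have hc := h.c_pos
  have hgj := h.gbar_pos j
  rcases Nat.lt_or_ge m j with hmj | hjm
  · rw [Finset.Icc_eq_empty_of_lt hmj, Finset.sum_empty]; positivity
  obtain ⟨s, hsN, hs⟩ := h.exc
  set T := Finset.Icc j m with hT
  have hmemT : ∀ l ∈ T, j ≤ l := fun l hl => (Finset.mem_Icc.1 hl).1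
  -- bad scales
  have hbad : ∑ l ∈ T.filter (· ∈ s), gbar β g₀ l ^ 2 ≤ N * gbar β g₀ j := by
    calc ∑ l ∈ T.filter (· ∈ s), gbar β g₀ l ^ 2 ≤ ∑ l ∈ T.filter (· ∈ s), gbar β g₀ j :=
          Finset.sum_le_sum fun l hl => h.gbar_sq_le (hmemT l (Finset.mem_filter.1 hl).1)
      _ = (T.filter (· ∈ s)).card * gbar β g₀ j := by rw [Finset.sum_const, nsmul_eq_mul]
      _ ≤ N * gbar β g₀ j := by
          gcongr
          exact (Finset.card_le_card fun l (hl : l ∈ T.filter (· ∈ s)) =>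
            (Finset.mem_filter.1 hl).2).trans hsN
  -- good scales: `cḡ_l² ≤ ḡ_l - ḡ_{l+1}`
  have hgood1 : ∀ l ∈ T.filter (· ∉ s), c * gbar β g₀ l ^ 2 ≤ gbar β g₀ l - gbar β g₀ (l + 1) := by
    intro l hl
    obtain ⟨hlT, hls⟩ := Finset.mem_filter.1 hl
    have hβ : c ≤ β l := hs l (hm l hlT) hls
    rw [gbar_succ]
    have := h.gbar_pos l
    nlinarith
  have htel : ∑ l ∈ T, (gbar β g₀ l - gbar β g₀ (l + 1)) ≤ gbar β g₀ j := by
    rw [hT, sum_Icc_sub_succ _ hjm]; linarith [h.gbar_pos (m + 1)]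
  have hbad2 : -∑ l ∈ T.filter (· ∈ s), (gbar β g₀ l - gbar β g₀ (l + 1)) ≤ N * gbar β g₀ j := by
    rw [← Finset.sum_neg_distrib]
    calc ∑ l ∈ T.filter (· ∈ s), -(gbar β g₀ l - gbar β g₀ (l + 1))
        ≤ ∑ l ∈ T.filter (· ∈ s), gbar β g₀ j := Finset.sum_le_sum fun l hl =>
          (neg_le_abs _).trans (h.abs_gbar_sub_succ_le (hmemT l (Finset.mem_filter.1 hl).1))
      _ = (T.filter (· ∈ s)).card * gbar β g₀ j := by rw [Finset.sum_const, nsmul_eq_mul]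
      _ ≤ N * gbar β g₀ j := by
          gcongr
          exact (Finset.card_le_card fun l (hl : l ∈ T.filter (· ∈ s)) =>
            (Finset.mem_filter.1 hl).2).trans hsN
  have hsplit := Finset.sum_filter_add_sum_filter_not T (· ∈ s)
    (fun l => gbar β g₀ l - gbar β g₀ (l + 1))
  have hgood : c * ∑ l ∈ T.filter (· ∉ s), gbar β g₀ l ^ 2 ≤ (1 + N) * gbar β g₀ j := by
    rw [Finset.mul_sum]
    calc ∑ l ∈ T.filter (· ∉ s), c * gbar β g₀ l ^ 2
        ≤ ∑ l ∈ T.filter (· ∉ s), (gbar β g₀ l - gbar β g₀ (l + 1)) := Finset.sum_le_sum hgood1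
      _ = ∑ l ∈ T, (gbar β g₀ l - gbar β g₀ (l + 1)) -
            ∑ l ∈ T.filter (· ∈ s), (gbar β g₀ l - gbar β g₀ (l + 1)) := by linarith
      _ ≤ gbar β g₀ j + N * gbar β g₀ j := by linarith
      _ = (1 + N) * gbar β g₀ j := by ring
  have hgood' : ∑ l ∈ T.filter (· ∉ s), gbar β g₀ l ^ 2 ≤ (1 + N) / c * gbar β g₀ j := by
    rw [div_mul_eq_mul_div, le_div_iff₀ hc]; linarith
  calc ∑ l ∈ T, gbar β g₀ l ^ 2
      = ∑ l ∈ T.filter (· ∈ s), gbar β g₀ l ^ 2 + ∑ l ∈ T.filter (· ∉ s), gbar β g₀ l ^ 2 :=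
        (Finset.sum_filter_add_sum_filter_not T (· ∈ s) _).symm
    _ ≤ N * gbar β g₀ j + (1 + N) / c * gbar β g₀ j := add_le_add hbad hgood'
    _ = ((1 + N) / c + N) * gbar β g₀ j := by ring

/-- The tail weights of an interval: `Σ_{l ∈ [j,m], l > k} Ω^{-(l-k)} ≤ (Ω/(Ω-1)) Ω^{-(j-k)₊}`.
[cite: BauerschmidtBrydgesSlade2015Flow, Lemma 2.1 (proof of (ii)(a), "due to the exponential decay")] -/
theorem sum_weight_filter_gt_le (j m : ℕ) :
    ∑ l ∈ (Finset.Icc j m).filter (fun l : ℕ => k < (l : ℕ∞)), cutoffWeight Ω k l ≤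
      Ω / (Ω - 1) * cutoffWeight Ω k j :=
  sum_cutoffWeight_le h.one_lt k _ j (fun _ hl => (Finset.mem_filter.1 hl).2)
    fun _ hl => (Finset.mem_Icc.1 (Finset.mem_filter.1 hl).1).1

/-- **[BBS-rg-flow, Lemma 2.1(ii)(a), (2.3) with `(n,m) = (2,0)`]**, explicit constant:
`Σ_{l=j}^m Ω^{-(l-k)₊} ḡ_l² ≤ ((1+N)/c + N + 2Ω/(Ω-1)) Ω^{-(j-k)₊} ḡ_j` for all `m ≥ j`
("`Σ_{l=j}^k χ_lḡ_l² ≤ C_{2,0} χ_jḡ_j`"). [cite: BauerschmidtBrydgesSlade2015Flow, Lemma 2.1(ii)(a), (2.3)] -/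
theorem sum_weight_mul_gbar_sq_le (j m : ℕ) :
    ∑ l ∈ Finset.Icc j m, cutoffWeight Ω k l * gbar β g₀ l ^ 2 ≤
      ((1 + N) / c + N + 2 * Ω / (Ω - 1)) * (cutoffWeight Ω k j * gbar β g₀ j) := by
  classical
  have hΩ := h.one_lt
  have hc := h.c_pos
  have hgj := h.gbar_pos j
  have hwj := h.weight_pos j
  set T := Finset.Icc j m with hT
  -- split at the cut-off
  have hsplit := (Finset.sum_filter_add_sum_filter_not T (fun l : ℕ => (l : ℕ∞) ≤ k)
    (fun l => cutoffWeight Ω k l * gbar β g₀ l ^ 2)).symm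
  -- below the cut-off
  have hA : ∑ l ∈ T.filter (fun l : ℕ => (l : ℕ∞) ≤ k), cutoffWeight Ω k l * gbar β g₀ l ^ 2 ≤
      ((1 + N) / c + N) * (cutoffWeight Ω k j * gbar β g₀ j) := by
    obtain ⟨m₁, -, hm₁⟩ := filter_le_cutoff_eq_Icc k j m
    have hle : ∀ l ∈ Finset.Icc j m₁, (l : ℕ∞) ≤ k := fun l hl => by
      have : l ∈ T.filter (fun l : ℕ => (l : ℕ∞) ≤ k) := by rw [hT, hm₁]; exact hl
      exact (Finset.mem_filter.1 this).2
    rw [hm₁]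
    rcases Nat.lt_or_ge m₁ j with hmj | hjm
    · rw [Finset.Icc_eq_empty_of_lt hmj, Finset.sum_empty]; positivity
    · -- here `j ≤ k`, so `w_j = 1` and `w_l = 1` on the interval
      have hjk : (j : ℕ∞) ≤ k := hle j (Finset.mem_Icc.2 ⟨le_rfl, hjm⟩)
      rw [cutoffWeight_eq_one_of_le hjk, one_mul]
      calc ∑ l ∈ Finset.Icc j m₁, cutoffWeight Ω k l * gbar β g₀ l ^ 2
          = ∑ l ∈ Finset.Icc j m₁, gbar β g₀ l ^ 2 :=
            Finset.sum_congr rfl fun l hl => by rw [cutoffWeight_eq_one_of_le (hle l hl), one_mul]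
        _ ≤ ((1 + N) / c + N) * gbar β g₀ j := h.sum_gbar_sq_le_of_le_cutoff j m₁ hle
  -- beyond the cut-off
  have hB : ∑ l ∈ T.filter (fun l : ℕ => ¬ (l : ℕ∞) ≤ k), cutoffWeight Ω k l * gbar β g₀ l ^ 2 ≤
      2 * Ω / (Ω - 1) * (cutoffWeight Ω k j * gbar β g₀ j) := by
    have hfilt : T.filter (fun l : ℕ => ¬ (l : ℕ∞) ≤ k) = T.filter (fun l : ℕ => k < (l : ℕ∞)) :=
      Finset.filter_congr fun l _ => not_le
    rw [hfilt]
    calc ∑ l ∈ T.filter (fun l : ℕ => k < (l : ℕ∞)), cutoffWeight Ω k l * gbar β g₀ l ^ 2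
        ≤ ∑ l ∈ T.filter (fun l : ℕ => k < (l : ℕ∞)), cutoffWeight Ω k l * gbar β g₀ j ^ 2 * 4 := by
          refine Finset.sum_le_sum fun l hl => ?_
          have hjl : j ≤ l := (Finset.mem_Icc.1 (Finset.mem_filter.1 hl).1).1
          have h1 := h.gbar_le_two_mul hjl; have h2 := h.gbar_pos l; have h3 := h.weight_pos l
          rw [mul_assoc]
          refine mul_le_mul_of_nonneg_left ?_ h3.le
          nlinarith
      _ = 4 * gbar β g₀ j ^ 2 * ∑ l ∈ T.filter (fun l : ℕ => k < (l : ℕ∞)), cutoffWeight Ω k l := by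
          rw [Finset.mul_sum]; refine Finset.sum_congr rfl ?_; intros; ring
      _ ≤ 4 * gbar β g₀ j ^ 2 * (Ω / (Ω - 1) * cutoffWeight Ω k j) :=
          mul_le_mul_of_nonneg_left (h.sum_weight_filter_gt_le j m) (by positivity)
      _ ≤ 2 * Ω / (Ω - 1) * (cutoffWeight Ω k j * gbar β g₀ j) := by
          have hg2 := h.gbar_le_half j
          have hΩ' : 0 ≤ Ω / (Ω - 1) := div_nonneg (by linarith) (by linarith)
          have : 4 * gbar β g₀ j ^ 2 ≤ 2 * gbar β g₀ j := by nlinarith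
          calc 4 * gbar β g₀ j ^ 2 * (Ω / (Ω - 1) * cutoffWeight Ω k j)
              ≤ 2 * gbar β g₀ j * (Ω / (Ω - 1) * cutoffWeight Ω k j) :=
                mul_le_mul_of_nonneg_right this (by positivity)
            _ = 2 * Ω / (Ω - 1) * (cutoffWeight Ω k j * gbar β g₀ j) := by ring
  rw [hsplit]
  calc _ ≤ ((1 + N) / c + N) * (cutoffWeight Ω k j * gbar β g₀ j) +
        2 * Ω / (Ω - 1) * (cutoffWeight Ω k j * gbar β g₀ j) := add_le_add hA hB
    _ = ((1 + N) / c + N + 2 * Ω / (Ω - 1)) * (cutoffWeight Ω k j * gbar β g₀ j) := by ring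

/-- The constant of (2.3) with `(n,m) = (2,0)` is non-negative. [cite: BauerschmidtBrydgesSlade2015Flow, Lemma 2.1(ii)(a)] -/
theorem C20_nonneg : 0 ≤ (1 + N) / c + N + 2 * Ω / (Ω - 1) := by
  have := h.c_pos; have := h.one_lt
  have : 0 ≤ 2 * Ω / (Ω - 1) := div_nonneg (by linarith) (by linarith)
  positivity

/-- Infinite-sum form of (2.3) with `(n,m) = (2,0)`: `Σ_{l ≥ j} Ω^{-(l-k)₊}ḡ_l²` converges and is
`≤ ((1+N)/c + N + 2Ω/(Ω-1)) Ω^{-(j-k)₊}ḡ_j`. [cite: BauerschmidtBrydgesSlade2015Flow, Lemma 2.1(ii)(a), (2.3)] -/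
theorem summable_weight_mul_gbar_sq (j : ℕ) :
    Summable (fun l => cutoffWeight Ω k (l + j) * gbar β g₀ (l + j) ^ 2) ∧
      ∑' l, cutoffWeight Ω k (l + j) * gbar β g₀ (l + j) ^ 2 ≤
        ((1 + N) / c + N + 2 * Ω / (Ω - 1)) * (cutoffWeight Ω k j * gbar β g₀ j) := by
  have hnn : ∀ l, 0 ≤ cutoffWeight Ω k (l + j) * gbar β g₀ (l + j) ^ 2 := fun l =>
    mul_nonneg (h.weight_pos _).le (sq_nonneg _)
  have hbd : ∀ n, ∑ l ∈ Finset.range n, cutoffWeight Ω k (l + j) * gbar β g₀ (l + j) ^ 2 ≤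
      ((1 + N) / c + N + 2 * Ω / (Ω - 1)) * (cutoffWeight Ω k j * gbar β g₀ j) := by
    intro n
    rcases n with _ | n
    · simp only [Finset.range_zero, Finset.sum_empty]
      exact mul_nonneg h.C20_nonneg (mul_nonneg (h.weight_pos j).le (h.gbar_pos j).le)
    · calc ∑ l ∈ Finset.range (n + 1), cutoffWeight Ω k (l + j) * gbar β g₀ (l + j) ^ 2
          = ∑ l ∈ Finset.Icc j (j + n), cutoffWeight Ω k l * gbar β g₀ l ^ 2 := by
            rw [Finset.range_eq_Ico, Finset.sum_Ico_add' (fun l => cutoffWeight Ω k l * gbar β g₀ l ^ 2),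
              zero_add, show n + 1 + j = j + n + 1 by ring, Finset.Ico_add_one_right_eq_Icc]
        _ ≤ _ := h.sum_weight_mul_gbar_sq_le j (j + n)
  exact ⟨summable_of_sum_range_le hnn hbd, Real.tsum_le_of_sum_range_le hnn hbd⟩

end CutoffGbarHyp


namespace CutoffGbarHyp

variable {β : ℕ → ℝ} {Ω : ℝ} {k : ℕ∞} {B c : ℝ} {N : ℕ} {g₀ : ℝ} (h : CutoffGbarHyp β Ω k B c N g₀)
include h

/-- `|log ḡ_m| = -log ḡ_m` (`ḡ_m ≤ 1/2 < 1`). [cite: BauerschmidtBrydgesSlade2015Flow, Lemma 2.1(ii)(a)] -/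
theorem abs_log_gbar (m : ℕ) : |Real.log (gbar β g₀ m)| = -Real.log (gbar β g₀ m) :=
  abs_of_nonpos (Real.log_nonpos (h.gbar_pos m).le (by linarith [h.gbar_le_half m]))

/-- `|log ḡ_m| ≥ 1/2` (`ḡ_m ≤ 1/2`, `log 2 > 1/2`): additive constants are absorbed by `|log ḡ_m|`.
[cite: BauerschmidtBrydgesSlade2015Flow, Lemma 2.1(ii)(a)] -/
theorem half_le_abs_log_gbar (m : ℕ) : 1 / 2 ≤ |Real.log (gbar β g₀ m)| := by
  rw [h.abs_log_gbar]
  have h1 : Real.log (gbar β g₀ m) ≤ Real.log (1 / 2) :=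
    Real.log_le_log (h.gbar_pos m) (h.gbar_le_half m)
  have h2 : Real.log (1 / 2) = -Real.log 2 := by rw [one_div, Real.log_inv]
  have h3 := Real.one_sub_inv_le_log_of_pos (show (0 : ℝ) < 2 by norm_num)
  norm_num at h3
  linarith

/-- On a good scale, `β_lḡ_l ≤ log(ḡ_l/ḡ_{l+1})` (`-log(1-x) ≥ x`), and in general
`log(ḡ_{l+1}/ḡ_l) = log(1 - β_lḡ_l) ≤ -β_lḡ_l ≤ 1/2`.
[cite: BauerschmidtBrydgesSlade2015Flow, Lemma 2.1 (proof of (ii)(a)–(b) with ψ(t) = t⁻¹, t⁻²: sums of β_lḡ_l against log ḡ)] -/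
theorem beta_mul_gbar_le_log_div (l : ℕ) :
    β l * gbar β g₀ l ≤ Real.log (gbar β g₀ l / gbar β g₀ (l + 1)) := by
  obtain ⟨h1, h2⟩ := h.one_sub_mem l
  have hg := h.gbar_pos l; have hg1 := h.gbar_pos (l + 1)
  have hq : gbar β g₀ l / gbar β g₀ (l + 1) = (1 - β l * gbar β g₀ l)⁻¹ := by
    rw [gbar_succ', ← div_div, div_self hg.ne', one_div]
  rw [hq, Real.log_inv]
  have := Real.log_le_sub_one_of_pos (show 0 < 1 - β l * gbar β g₀ l by linarith)
  linarith

/-- `log(ḡ_l/ḡ_{l+1}) ≥ -1/2` on every scale (`1 - β_lḡ_l ≤ 3/2`).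
[cite: BauerschmidtBrydgesSlade2015Flow, Lemma 2.1 (proof of (ii)(a))] -/
theorem neg_half_le_log_div (l : ℕ) : -(1 / 2) ≤ Real.log (gbar β g₀ l / gbar β g₀ (l + 1)) := by
  obtain ⟨h1, h2⟩ := h.one_sub_mem l
  have hg := h.gbar_pos l
  have hq : gbar β g₀ l / gbar β g₀ (l + 1) = (1 - β l * gbar β g₀ l)⁻¹ := by
    rw [gbar_succ', ← div_div, div_self hg.ne', one_div]
  rw [hq, Real.log_inv]
  have := Real.log_le_sub_one_of_pos (show 0 < 1 - β l * gbar β g₀ l by linarith)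
  linarith

/-- The part of (2.3) with `(n,m) = (1,0)` below the cut-off: for an interval `[j, m]` of scales
`≤ k`, `Σ_{l=j}^m ḡ_l ≤ c⁻¹(|log ḡ_{m+1}| + N/2) + N/2`.
[cite: BauerschmidtBrydgesSlade2015Flow, Lemma 2.1(ii)(a), (2.3) with n = 1 (proof via (2.4), ψ(t) = t⁻¹)] -/
theorem sum_gbar_le_of_le_cutoff (j m : ℕ) (hm : ∀ l ∈ Finset.Icc j m, (l : ℕ∞) ≤ k) :
    ∑ l ∈ Finset.Icc j m, gbar β g₀ l ≤
      c⁻¹ * (|Real.log (gbar β g₀ (m + 1))| + N / 2) + N / 2 := by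
  classical
  have hc := h.c_pos
  have habs := h.half_le_abs_log_gbar (m + 1)
  rcases Nat.lt_or_ge m j with hmj | hjm
  · rw [Finset.Icc_eq_empty_of_lt hmj, Finset.sum_empty]; positivity
  obtain ⟨s, hsN, hs⟩ := h.exc
  set T := Finset.Icc j m with hT
  have hcardR : ((T.filter (· ∈ s)).card : ℝ) ≤ N := by
    exact_mod_cast (Finset.card_le_card fun l (hl : l ∈ T.filter (· ∈ s)) =>
      (Finset.mem_filter.1 hl).2).trans hsN
  -- bad scales: `ḡ_l ≤ 1/2`
  have hbad : ∑ l ∈ T.filter (· ∈ s), gbar β g₀ l ≤ N / 2 := by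
    calc ∑ l ∈ T.filter (· ∈ s), gbar β g₀ l ≤ ∑ l ∈ T.filter (· ∈ s), (1 / 2 : ℝ) :=
          Finset.sum_le_sum fun l _ => h.gbar_le_half l
      _ = (T.filter (· ∈ s)).card * (1 / 2) := by rw [Finset.sum_const, nsmul_eq_mul]
      _ ≤ N / 2 := by linarith
  -- telescoping of the logarithms over the whole interval
  set L : ℕ → ℝ := fun l => Real.log (gbar β g₀ l / gbar β g₀ (l + 1)) with hL
  have hLtel : ∑ l ∈ T, L l ≤ |Real.log (gbar β g₀ (m + 1))| := by
    have : ∀ l ∈ T, L l = Real.log (gbar β g₀ l) - Real.log (gbar β g₀ (l + 1)) := fun l _ => by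
      simp only [hL]; rw [Real.log_div (h.gbar_pos l).ne' (h.gbar_pos (l + 1)).ne']
    rw [Finset.sum_congr rfl this, hT, sum_Icc_sub_succ _ hjm, h.abs_log_gbar]
    have := Real.log_nonpos (h.gbar_pos j).le (by linarith [h.gbar_le_half j])
    linarith
  have hLbad : -∑ l ∈ T.filter (· ∈ s), L l ≤ N / 2 := by
    rw [← Finset.sum_neg_distrib]
    calc ∑ l ∈ T.filter (· ∈ s), -L l ≤ ∑ l ∈ T.filter (· ∈ s), (1 / 2 : ℝ) :=
          Finset.sum_le_sum fun l _ => by linarith [h.neg_half_le_log_div l]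
      _ = (T.filter (· ∈ s)).card * (1 / 2) := by rw [Finset.sum_const, nsmul_eq_mul]
      _ ≤ N / 2 := by linarith
  have hsplitL := Finset.sum_filter_add_sum_filter_not T (· ∈ s) L
  -- good scales: `cḡ_l ≤ β_lḡ_l ≤ L_l`
  have hgood : c * ∑ l ∈ T.filter (· ∉ s), gbar β g₀ l ≤ |Real.log (gbar β g₀ (m + 1))| + N / 2 := by
    rw [Finset.mul_sum]
    calc ∑ l ∈ T.filter (· ∉ s), c * gbar β g₀ l ≤ ∑ l ∈ T.filter (· ∉ s), L l := by
          refine Finset.sum_le_sum fun l hl => ?_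
          obtain ⟨hlT, hls⟩ := Finset.mem_filter.1 hl
          have hβ : c ≤ β l := hs l (hm l hlT) hls
          calc c * gbar β g₀ l ≤ β l * gbar β g₀ l :=
                mul_le_mul_of_nonneg_right hβ (h.gbar_pos l).le
            _ ≤ L l := h.beta_mul_gbar_le_log_div l
      _ = ∑ l ∈ T, L l - ∑ l ∈ T.filter (· ∈ s), L l := by linarith
      _ ≤ |Real.log (gbar β g₀ (m + 1))| + N / 2 := by linarith
  have hgood' : ∑ l ∈ T.filter (· ∉ s), gbar β g₀ l ≤ c⁻¹ * (|Real.log (gbar β g₀ (m + 1))| + N / 2) := by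
    rw [← div_eq_inv_mul, le_div_iff₀ hc]; linarith
  calc ∑ l ∈ T, gbar β g₀ l
      = ∑ l ∈ T.filter (· ∈ s), gbar β g₀ l + ∑ l ∈ T.filter (· ∉ s), gbar β g₀ l :=
        (Finset.sum_filter_add_sum_filter_not T (· ∈ s) _).symm
    _ ≤ N / 2 + c⁻¹ * (|Real.log (gbar β g₀ (m + 1))| + N / 2) := add_le_add hbad hgood'
    _ = _ := by ring

/-- `|log ḡ_{m₁+1}| ≤ |log ḡ_m| + 2` for `m₁ ≤ m` (as `ḡ_{m₁+1} ≥ ḡ_{m+1}/2 ≥ ḡ_m/4`).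
[cite: BauerschmidtBrydgesSlade2015Flow, Lemma 2.1(i), (2.2)] -/
theorem abs_log_gbar_succ_le {m₁ m : ℕ} (hm : m₁ ≤ m) :
    |Real.log (gbar β g₀ (m₁ + 1))| ≤ |Real.log (gbar β g₀ m)| + 2 := by
  rw [h.abs_log_gbar, h.abs_log_gbar]
  have h1 : gbar β g₀ (m + 1) ≤ 2 * gbar β g₀ (m₁ + 1) := h.gbar_le_two_mul (by omega)
  have h2 : gbar β g₀ m / 2 ≤ gbar β g₀ (m + 1) := (h.gbar_succ_mem m).1
  have hgm := h.gbar_pos m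
  have h3 : gbar β g₀ m / 4 ≤ gbar β g₀ (m₁ + 1) := by linarith
  have h4 : Real.log (gbar β g₀ m / 4) ≤ Real.log (gbar β g₀ (m₁ + 1)) :=
    Real.log_le_log (by positivity) h3
  rw [Real.log_div hgm.ne' (by norm_num)] at h4
  have h5 : Real.log 4 = 2 * Real.log 2 := by
    rw [show (4 : ℝ) = 2 ^ 2 by norm_num, Real.log_pow]; norm_num
  have h6 := Real.log_le_sub_one_of_pos (show (0 : ℝ) < 2 by norm_num)
  linarith

/-- **[BBS-rg-flow, Lemma 2.1(ii)(a), (2.3) with `(n,m) = (1,0)`]**, explicit constant: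
`Σ_{l=j}^m Ω^{-(l-k)₊} ḡ_l ≤ ((5+N)/c + N + Ω/(Ω-1)) |log ḡ_m|`
("`Σ_{l=j}^k χ_lḡ_l ≤ C_{1,0}|log ḡ_k|`"). [cite: BauerschmidtBrydgesSlade2015Flow, Lemma 2.1(ii)(a), (2.3)] -/
theorem sum_weight_mul_gbar_le (j m : ℕ) :
    ∑ l ∈ Finset.Icc j m, cutoffWeight Ω k l * gbar β g₀ l ≤
      ((5 + N) / c + N + Ω / (Ω - 1)) * |Real.log (gbar β g₀ m)| := by
  classical
  have hΩ := h.one_lt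
  have hc := h.c_pos
  have hgj := h.gbar_pos j
  have hwj := h.weight_pos j
  have hwj1 := h.weight_le_one j
  have habs := h.half_le_abs_log_gbar m
  set T := Finset.Icc j m with hT
  set A := |Real.log (gbar β g₀ m)| with hAdef
  have hsplit := (Finset.sum_filter_add_sum_filter_not T (fun l : ℕ => (l : ℕ∞) ≤ k)
    (fun l => cutoffWeight Ω k l * gbar β g₀ l)).symm
  -- below the cut-off
  have hA : ∑ l ∈ T.filter (fun l : ℕ => (l : ℕ∞) ≤ k), cutoffWeight Ω k l * gbar β g₀ l ≤
      c⁻¹ * (A + 2 + N / 2) + N / 2 := by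
    obtain ⟨m₁, hm₁m, hm₁⟩ := filter_le_cutoff_eq_Icc k j m
    have hle : ∀ l ∈ Finset.Icc j m₁, (l : ℕ∞) ≤ k := fun l hl => by
      have : l ∈ T.filter (fun l : ℕ => (l : ℕ∞) ≤ k) := by rw [hT, hm₁]; exact hl
      exact (Finset.mem_filter.1 this).2
    rw [hm₁]
    have hlog := h.abs_log_gbar_succ_le hm₁m
    calc ∑ l ∈ Finset.Icc j m₁, cutoffWeight Ω k l * gbar β g₀ l
        = ∑ l ∈ Finset.Icc j m₁, gbar β g₀ l :=
          Finset.sum_congr rfl fun l hl => by rw [cutoffWeight_eq_one_of_le (hle l hl), one_mul]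
      _ ≤ c⁻¹ * (|Real.log (gbar β g₀ (m₁ + 1))| + N / 2) + N / 2 := h.sum_gbar_le_of_le_cutoff j m₁ hle
      _ ≤ c⁻¹ * (A + 2 + N / 2) + N / 2 := by
          have : 0 ≤ c⁻¹ := by positivity
          nlinarith
  -- beyond the cut-off
  have hB : ∑ l ∈ T.filter (fun l : ℕ => ¬ (l : ℕ∞) ≤ k), cutoffWeight Ω k l * gbar β g₀ l ≤
      Ω / (Ω - 1) / 2 := by
    have hfilt : T.filter (fun l : ℕ => ¬ (l : ℕ∞) ≤ k) = T.filter (fun l : ℕ => k < (l : ℕ∞)) :=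
      Finset.filter_congr fun l _ => not_le
    rw [hfilt]
    have hΩ' : 0 ≤ Ω / (Ω - 1) := div_nonneg (by linarith) (by linarith)
    calc ∑ l ∈ T.filter (fun l : ℕ => k < (l : ℕ∞)), cutoffWeight Ω k l * gbar β g₀ l
        ≤ ∑ l ∈ T.filter (fun l : ℕ => k < (l : ℕ∞)), cutoffWeight Ω k l * (2 * g₀) :=
          Finset.sum_le_sum fun l _ =>
            mul_le_mul_of_nonneg_left (h.gbar_le_two_mul_init l) (h.weight_pos l).le
      _ = 2 * g₀ * ∑ l ∈ T.filter (fun l : ℕ => k < (l : ℕ∞)), cutoffWeight Ω k l := by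
          rw [Finset.mul_sum]; refine Finset.sum_congr rfl ?_; intros; ring
      _ ≤ 2 * g₀ * (Ω / (Ω - 1) * cutoffWeight Ω k j) :=
          mul_le_mul_of_nonneg_left (h.sum_weight_filter_gt_le j m) (by linarith [h.g₀_pos])
      _ ≤ 2 * (1 / 4) * (Ω / (Ω - 1) * 1) := by
          have := h.g₀_le; have := h.g₀_pos
          gcongr
      _ = Ω / (Ω - 1) / 2 := by ring
  rw [hsplit]
  have hK : c⁻¹ * (A + 2 + N / 2) + N / 2 + Ω / (Ω - 1) / 2 ≤ ((5 + N) / c + N + Ω / (Ω - 1)) * A := by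
    -- absorb the additive constants using `1 ≤ 2A`
    have h2A : 1 ≤ 2 * A := by linarith
    have hcinv : 0 ≤ c⁻¹ := by positivity
    have hΩ' : 0 ≤ Ω / (Ω - 1) := div_nonneg (by linarith) (by linarith)
    have hNn : (0 : ℝ) ≤ N := Nat.cast_nonneg N
    have e : ((5 + N) / c + N + Ω / (Ω - 1)) * A =
        c⁻¹ * A + (c⁻¹ * (4 + N) + N + Ω / (Ω - 1)) * A := by rw [div_eq_inv_mul]; ring
    rw [e]
    have : c⁻¹ * (2 + N / 2) + N / 2 + Ω / (Ω - 1) / 2 ≤ (c⁻¹ * (4 + N) + N + Ω / (Ω - 1)) * A := by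
      have hx : 0 ≤ c⁻¹ * (4 + N) + N + Ω / (Ω - 1) := by positivity
      calc c⁻¹ * (2 + N / 2) + N / 2 + Ω / (Ω - 1) / 2
          = (c⁻¹ * (4 + N) + N + Ω / (Ω - 1)) * (1 / 2) := by ring
        _ ≤ (c⁻¹ * (4 + N) + N + Ω / (Ω - 1)) * A := mul_le_mul_of_nonneg_left (by linarith) hx
    nlinarith
  linarith [add_le_add hA hB]

end CutoffGbarHyp

/-! ### From Assumption (A1) to the hypotheses above: the threshold for `g₀` -/

/-- An explicit threshold `g₁(Ω, B, c) = (4(1 + B)(1 + ⌊c⁻¹⌋ + 1/(Ω-1)))⁻¹` below which all the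
smallness conditions of `CutoffGbarHyp` hold ("if `ḡ₀ > 0` is sufficiently small, with all constants
independent of `j_Ω` and `ḡ₀`"). [cite: BauerschmidtBrydgesSlade2015Flow, Lemma 2.1 (preamble)] -/
def gbarThreshold (Ω B c : ℝ) : ℝ := (4 * (1 + B) * (1 + ⌊c⁻¹⌋₊ + 1 / (Ω - 1)))⁻¹

/-- The threshold is positive (for `Ω > 1`, `B ≥ 0`). [cite: BauerschmidtBrydgesSlade2015Flow, Lemma 2.1 (preamble)] -/
theorem gbarThreshold_pos {Ω B c : ℝ} (hΩ : 1 < Ω) (hB : 0 ≤ B) : 0 < gbarThreshold Ω B c := by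
  unfold gbarThreshold
  have : 0 < 1 / (Ω - 1) := div_pos one_pos (by linarith)
  positivity

namespace HypA1

variable {β : ℕ → ℝ} {Ω B c : ℝ} (hA : HypA1 β Ω B c)
include hA

/-- `B ≥ 0`. [cite: BauerschmidtBrydgesSlade2015Flow, Assumption (A1)] -/
theorem B_nonneg : 0 ≤ B := (abs_nonneg _).trans (hA.abs_le 0)

/-- `β_max ≤ B`. [cite: BauerschmidtBrydgesSlade2015Flow, Assumption (A1)] -/
theorem betaMax_le : betaMax β ≤ B := ciSup_le hA.abs_le

/-- `|β_j| ≤ Bχ_j` (Assumption (A1) and the definition (1.7)–(1.8) of `j_Ω`, `χ_j`).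
[cite: BauerschmidtBrydgesSlade2015Flow, §1.3, (1.7)–(1.8) and Assumption (A1)] -/
theorem abs_le_mul_chi (hΩ : 1 ≤ Ω) (j : ℕ) : |β j| ≤ B * chi β Ω j := by
  have hb : BddAbove (Set.range fun j => |β j|) := ⟨B, by rintro _ ⟨j, rfl⟩; exact hA.abs_le j⟩
  calc |β j| ≤ chi β Ω j * betaMax β := abs_le_chi_mul_betaMax hb Ω j
    _ ≤ chi β Ω j * B :=
        mul_le_mul_of_nonneg_left hA.betaMax_le (chi_pos_and_le_one β hΩ j).1.le
    _ = B * chi β Ω j := mul_comm _ _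

/-- **Assumption (A1) implies the hypotheses of Lemma 2.1** at the cut-off `k = j_Ω`, with
`N = ⌊c⁻¹⌋` exceptional scales, for every `0 < g₀ ≤ g₁(Ω, B, c)`.
[cite: BauerschmidtBrydgesSlade2015Flow, Assumption (A1) and Lemma 2.1] -/
theorem cutoffGbarHyp (hΩ : 1 < Ω) {g₀ : ℝ} (hg₀ : 0 < g₀) (hsmall : g₀ ≤ gbarThreshold Ω B c) :
    CutoffGbarHyp β Ω (jOmega β Ω) B c ⌊c⁻¹⌋₊ g₀ := by
  have hB := hA.B_nonneg
  set N : ℕ := ⌊c⁻¹⌋₊ with hN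
  have hx : 0 < 1 / (Ω - 1) := div_pos one_pos (by linarith)
  set D : ℝ := 4 * (1 + B) * (1 + N + 1 / (Ω - 1)) with hD
  have hD4 : 4 ≤ D := by
    have : (1 : ℝ) ≤ (1 + B) * (1 + N + 1 / (Ω - 1)) := by nlinarith [Nat.cast_nonneg (α := ℝ) N]
    nlinarith
  have hDpos : 0 < D := by linarith
  have hgD : g₀ * D ≤ 1 := by
    have : g₀ ≤ D⁻¹ := hsmall
    rwa [le_inv_comm₀ hg₀ hDpos, ← one_div, le_div_iff₀ hg₀, mul_comm] at this
  obtain ⟨s, hs, hs'⟩ := hA.exc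
  refine ⟨hΩ, fun j => hA.abs_le_mul_chi hΩ.le j, hA.c_pos, ⟨s, ?_, hs'⟩, hg₀, ?_, ?_, ?_⟩
  · exact Nat.le_floor hs
  · nlinarith
  · -- `Bg₀ ≤ 1/4`: `B ≤ D/4`
    have : 4 * B ≤ D := by nlinarith [Nat.cast_nonneg (α := ℝ) N]
    nlinarith
  · -- `2Bg₀(N + 1/(Ω-1)) ≤ 1/2`: `4B(N + 1/(Ω-1)) ≤ D`
    have : 4 * B * (N + 1 / (Ω - 1)) ≤ D := by nlinarith [Nat.cast_nonneg (α := ℝ) N]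
    have hN0 : (0 : ℝ) ≤ N + 1 / (Ω - 1) := by positivity
    nlinarith [mul_nonneg hB hN0]

end HypA1


end CTWSAW

end Literature.Barriers.CriticalPhenomena
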